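/-
Copyright (c) 2026 the pub-hodgecm-mathlib formalisation cell (harness21).  Typist seat hodgecm-mathlib-R90-C11-typ1 (g4), R90-TF section S2 «Ch11-arch»
(S2 dealer K2E1b-plan (g8), DESK WORDS ×6 2026-09-05T02:47:25Z item (3): «then FREE → next by name: the OF-LETTERS TIES … SIG-first, one file per socket»):
the OF-LETTERS TIE for socket σ5 (KT1): the archimedean inner-transfer law of the kit of record at the families `(m′, m)` FROM the `∀`-closure of letter ℓ5.
-/
import Summits.HodgeConjecture.HodgeConjecture.Theorems.R90S2InnerTransferLawLettersDefs   -- ★ the KT-side letters ℓ5 ∕ ℓ6 ∕ ℓ7 (R90-C11-typ1 (g4), filed by K2-defs1 (g8)): `InnerTransferCharLetter`, `EndoCharXiLetter`, `StableVirtualCharLetter` + their `_iff`s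
import HarnessLib

/-!
# R90 ∕ S2 «Ch11-arch», OF-LETTERS TIE (T5) for socket σ5 `stub_R90_S2_KT1` —
# `R90_S2_KT1_of_letters : (∀ P, InnerTransferCharLetter L ι H T hT νGi νqi m′ m P) → rogawskiArchKit.InnerTransferLawTest L H m′ m (archTrGOfRecord L ι νqi) (archTr₀ L ι H T hT νGi)`

Cell `pub/hodgecm-mathlib` (D-0151), crux H413 = `stmt-HodgeConjecture-24833` (`--supports … --as helper`; closes nothing by itself).  ONE theorem, no definition ∕
instance ∕ notation ∕ named fact ∕ `sorry`; sole project import = ★ `R90S2InnerTransferLawLettersDefs` (LAW L9 ∕ S2-R10′ «DEFS DOWN»: a `Theorems` file never imports a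
`Cruxes/…/Lines` module — so the orbital families `m′` on `G′_∞ = U(H)_∞` and `m` on `G_∞ = U(Φ₃)_∞` are PARAMETERS here, in ℓ5's binder bytes; the Lines edition
instantiates them at a `ComparisonKit`'s `(𝔨.mGi, 𝔨.mqi)` under `𝔨.ArchCoherence hanis νGi νqi νHi`).
THE TIE (ExportA, next edition, socket σ5 `stub_R90_S2_KT1` :179–:203, statement FROZEN): after `intro hanis 𝔨 hcoh` the goal is LITERALLY
`rogawskiArchKit.InnerTransferLawTest L H 𝔨.mGi 𝔨.mqi (archTrGOfRecord L ι νqi) (UnitaryGroup.archTr₀ L ι H T hT νGi)`, closed by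
`exact R90_S2_KT1_of_letters L ι H T hT νGi νqi 𝔨.mGi 𝔨.mqi ‹the ℓ5 instances at 𝔨, from the edition's letter-stub›` (junction certified in the socket's own frame:
typ1 (g4) scratch `JUNCTION-L567.v0.lean` 01215cf9e76d3eff, J-L5a∕b).  The proof is modus ponens on ★ `innerTransferCharLetter_iff` (`Iff.rfl`: the `∀`-closure of ℓ5 IS the
law test, ★ `rogawskiArchKit_memInf` ∕ `_oneInf` ∕ `trPktInf_eq` being `rfl`).  Print: §14.4 p. 234 last paragraph «`Tr(Π(f′_v)) = Tr(Π(f_v))`», Prop. 14.4.1 (c) p. 235,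
Prop. 14.4.2 p. 236, for (14.2.1)-transfer pairs `f′_∞ ↦ f_∞` (§14.2 p. 232) [Shelstad1979].
HONEST LABEL: HC_CM is proved only modulo the 7 printed citations (2 remaining named inputs: hLiu418 = stmt-HodgeConjecture-24832, h413 =
stmt-HodgeConjecture-24833) until rung 0 closes; this file proves ONE implication of an `Iff` already in the tree — it discharges no socket by itself (the
letter instances it consumes are typed debt stated by the Lines edition), establishes no character identity, and leaves the code-`sorry` count of record unchanged.

## References
* [Rogawski1990] J. Rogawski, *Automorphic Representations of Unitary Groups in Three Variables*, Annals of Math. Studies 123 (1990), §14.2 (14.2.1) p. 232; §14.4 pp. 234–236.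
* [Shelstad1979] D. Shelstad, *Characters and inner forms of a quasi-split group over `ℝ`*, Compositio Math. 39 (1979), Introduction.
-/

set_option autoImplicit false
set_option linter.dupNamespace false

noncomputable section

open MeasureTheory MeasureTheory.Measure NumberField IsDedekindDomain
open scoped Matrix MatrixGroups Classical

namespace Summit.HodgeConjecture.HodgeConjecture.R90.S2

open Literature.NumberTheory Literature.NumberTheory.Automorphic Literature.NumberTheory.Automorphic.UnitaryGroup
open Literature.NumberTheory.Rogawski1990 Literature.NumberTheory.GaloisRepresentations
open Literature.RepresentationTheory
open Literature.RepresentationTheory.KonnoKonno2007 Literature.RepresentationTheory.KonnoKonno2007.RealDualPair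
open Literature.RepresentationTheory.KonnoKonno2007.RealDualPair.UForm
open Summit.HodgeConjecture.HodgeConjecture.Cruxes.H413
open Summit.HodgeConjecture.HodgeConjecture.Cruxes.H413.F0P3InnerFormClassificationV6 (Gp Places Cinf)
open Summit.HodgeConjecture.HodgeConjecture.Cruxes.H413.F0P3XiArchPacketOfRecord (archPacketAt archPacketAt_πn_of_not)
open Summit.HodgeConjecture.HodgeConjecture.Cruxes.H413.F0P3ArchPacketKit
open Summit.HodgeConjecture.HodgeConjecture.Cruxes.H413.K2E1bCarriersOfRecord (jInfOfRecord dsInfOfRecord)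

/-- **(T5) σ5 FROM THE LETTERS ℓ5** — for the inner form `U(H)` (ball frame `T, hT`), the measures `νGi` on `G′_∞`, `νqi` on `G_∞` and the orbital families `(m′, m)`:
if letter ℓ5 holds at EVERY archimedean packet label `P` (★ `InnerTransferCharLetter`: the signed packet traces `Σ_{c∈P} ⟨1,c⟩ Θ_c(f_∞)` and `Σ_{c∈P} ⟨1,c⟩ Θ′_c(f′_∞)` agree
for every `C_c^∞` inner-transfer pair), then the kit of record passes the archimedean inner-transfer law test ★ `rogawskiArchKit.InnerTransferLawTest` at `(m′, m)` against
`Θ := archTrGOfRecord L ι νqi`, `Θ′ := archTr₀ L ι H T hT νGi` — σ5's goal after `intro hanis 𝔨 hcoh`, at `m′ := 𝔨.mGi`, `m := 𝔨.mqi`.  Modus ponens on ★ `innerTransferCharLetter_iff`.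
[cite: Rogawski1990, §14.4 p. 234 last paragraph, Prop. 14.4.1 (c) p. 235, Prop. 14.4.2 p. 236; §14.2 (14.2.1) p. 232] [cite: Shelstad1979, Introduction] -/
theorem R90_S2_KT1_of_letters (L : Type) [Field L] [NumberField L] [IsCMField L] (ι : L →+* ℂ) (H : Matrix (Fin 3) (Fin 3) L) (T : GL (Fin 3) ℂ)
    (hT : (T : Matrix (Fin 3) (Fin 3) ℂ)ᴴ * H.map ι * (T : Matrix (Fin 3) (Fin 3) ℂ) = Literature.Geometry.ComplexHyperbolic.BallModel.J)
    (νGi : @Measure (UnitaryGroup.arch (↥(maximalRealSubfield L)) L (IsCMField.complexConj L) 3 H) (borel _))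
    (νqi : @Measure (UnitaryGroup.arch (↥(maximalRealSubfield L)) L (IsCMField.complexConj L) 3 (F0P3InnerFormClassificationV6.splitForm L 3)) (borel _))
    (m' : letI : ∀ γ : UnitaryGroup.arch (↥(maximalRealSubfield L)) L (IsCMField.complexConj L) 3 H,
        MeasurableSpace (UnitaryGroup.arch (↥(maximalRealSubfield L)) L (IsCMField.complexConj L) 3 H ⧸
          Subgroup.centralizer ({γ} : Set (UnitaryGroup.arch (↥(maximalRealSubfield L)) L (IsCMField.complexConj L) 3 H))) := fun _ => borel _;
      OrbitalMeasureFamily (UnitaryGroup.arch (↥(maximalRealSubfield L)) L (IsCMField.complexConj L) 3 H))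
    (m : letI : ∀ γ : UnitaryGroup.arch (↥(maximalRealSubfield L)) L (IsCMField.complexConj L) 3 (F0P3InnerFormClassificationV6.splitForm L 3),
        MeasurableSpace (UnitaryGroup.arch (↥(maximalRealSubfield L)) L (IsCMField.complexConj L) 3 (F0P3InnerFormClassificationV6.splitForm L 3) ⧸
          Subgroup.centralizer ({γ} : Set (UnitaryGroup.arch (↥(maximalRealSubfield L)) L (IsCMField.complexConj L) 3 (F0P3InnerFormClassificationV6.splitForm L 3)))) := fun _ => borel _;
      OrbitalMeasureFamily (UnitaryGroup.arch (↥(maximalRealSubfield L)) L (IsCMField.complexConj L) 3 (F0P3InnerFormClassificationV6.splitForm L 3)))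
    (hℓ5 : ∀ P : ArchPktLabel, InnerTransferCharLetter L ι H T hT νGi νqi m' m P) :
    rogawskiArchKit.InnerTransferLawTest L H m' m (archTrGOfRecord L ι νqi) (UnitaryGroup.archTr₀ L ι H T hT νGi) :=
  (innerTransferCharLetter_iff L ι H T hT νGi νqi m' m).1 hℓ5

end Summit.HodgeConjecture.HodgeConjecture.R90.S2

end
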